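import Summits.NavierStokesRegularity.NavierStokesRegularity.Theorems.ScarRigidity.Negative.NeutralModeProfile
import Literature.Analysis.FluidPDE.CaloricRemainderCalculus
import Literature.Analysis.FluidPDE.SpaceTimeMollifier
import HarnessLib

/-!
# Zero-scar neutral mode of the linearised Leray operator — part 2/3: the identity and the size bounds

Negative-side support for the crux `ScarRigidity` (stmt-NavierStokesRegularity-11717, route RellichScar),
cdisprove seat, cycle 3 (see part 3, `NeutralMode`, for the refuted statements and their meaning).  For the
fields `W, Π, M` of part 1 (`NeutralModeProfile`):

* pointwise formulas: `DW(y)y` (`fderiv_neutralW_self`), `ΔW` (`laplacian_neutralW`, through the tree's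
  `laplacian_smul_const` / `laplacian_smul_field` / `laplacian_mul_eq`), `∇Π` (`gradient_neutralP`),
  `M W = θ (A+σB)(m·y) y` (`neutralM_apply_neutralW`); **`div W = 0`** (`divergence_neutralW`);
* **THE IDENTITY** `neutral_identity`: `ΔW − ½(y·∇)W − ½W − M W − ∇Π = 0` on all of `ℝ³` (coefficients
  of `m` and `y` matched by `match_scalars`, each a polynomial identity in `σ = |y|²`, `ζ` modulo
  `ζ²(1+σ) = 1`, closed by `linear_combination`);
* sizes: `‖W(y)‖² ≤ 4/(1+|y|²)³` (`norm_neutralW_sq_le`, `|m| = 1`; equality on the axis), the polynomial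
  inequality `σ|4σ²+57σ−73| ≤ 8(1+σ)³` (`poly_bound`) and **`‖M(y)‖ ≤ 30/(1+|y|²)`** (`norm_neutralM_le`;
  numerically `sup (1+|y|²)‖M‖ ≈ 28.4`, `‖M‖ ~ 15/|y|²` at infinity), `W(0) = 2m` (`neutralW_zero`).
-/

noncomputable section

open Set Filter Function MeasureTheory Metric TopologicalSpace InnerProductSpace
open scoped Topology ENNReal NNReal RealInnerProductSpace Laplacian

set_option linter.dupNamespace false

namespace Summit.NavierStokesRegularity.NavierStokesRegularity.Theorems.ScarRigidity.Negative

open Literature.Analysis.FluidPDE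

/-- Physical / similarity space. -/
local notation "ℝ³" => EuclideanSpace ℝ (Fin 3)

/-! ### §7.6 The four pointwise formulas -/

section Formulas

variable (m : ℝ³)

/-- `A' = A₁` (quantified form for the radial-calculus lemmas). [folklore] -/
theorem modeA_deriv : ∀ σ : ℝ, -1 < σ → HasDerivAt modeA (modeA₁ σ) σ := fun _ h => hasDerivAt_modeA h
/-- `A₁' = A₂` (quantified form). [folklore] -/
theorem modeA₁_deriv : ∀ σ : ℝ, -1 < σ → HasDerivAt modeA₁ (modeA₂ σ) σ := fun _ h => hasDerivAt_modeA₁ h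
/-- `B' = B₁` (quantified form). [folklore] -/
theorem modeB_deriv : ∀ σ : ℝ, -1 < σ → HasDerivAt modeB (modeB₁ σ) σ := fun _ h => hasDerivAt_modeB h
/-- `B₁' = B₂` (quantified form). [folklore] -/
theorem modeB₁_deriv : ∀ σ : ℝ, -1 < σ → HasDerivAt modeB₁ (modeB₂ σ) σ := fun _ h => hasDerivAt_modeB₁ h
/-- `ϖ' = ϖ₁` (quantified form). [folklore] -/
theorem modeP_deriv : ∀ σ : ℝ, -1 < σ → HasDerivAt modeP (modeP₁ σ) σ := fun _ h => hasDerivAt_modeP h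

/-- The derivative of `W` (as a continuous linear map). -/
theorem hasFDerivAt_neutralW (y : ℝ³) :
    HasFDerivAt (neutralW m)
      (((2 * modeA₁ (‖y‖ ^ 2)) • (innerSL ℝ y : ℝ³ →L[ℝ] ℝ)).smulRight m +
        ((modeB (‖y‖ ^ 2) * ⟪m, y⟫) • ContinuousLinearMap.id ℝ ℝ³ +
          (modeB (‖y‖ ^ 2) • (innerSL ℝ m : ℝ³ →L[ℝ] ℝ) +
            ⟪m, y⟫ • ((2 * modeB₁ (‖y‖ ^ 2)) • (innerSL ℝ y : ℝ³ →L[ℝ] ℝ))).smulRight y)) y := by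
  have h₁ : HasFDerivAt (fun w : ℝ³ => modeA (‖w‖ ^ 2) • m)
      (((2 * modeA₁ (‖y‖ ^ 2)) • (innerSL ℝ y : ℝ³ →L[ℝ] ℝ)).smulRight m) y :=
    (hasFDerivAt_radial modeA_deriv y).smul_const m
  have h₂ : HasFDerivAt (fun w : ℝ³ => (modeB (‖w‖ ^ 2) * ⟪m, w⟫) • w)
      ((modeB (‖y‖ ^ 2) * ⟪m, y⟫) • ContinuousLinearMap.id ℝ ℝ³ +
        (modeB (‖y‖ ^ 2) • (innerSL ℝ m : ℝ³ →L[ℝ] ℝ) +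
          ⟪m, y⟫ • ((2 * modeB₁ (‖y‖ ^ 2)) • (innerSL ℝ y : ℝ³ →L[ℝ] ℝ))).smulRight y) y :=
    (hasFDerivAt_radial_mul_inner m modeB_deriv y).fun_smul (hasFDerivAt_id y)
  exact h₁.add h₂

/-- `(y·∇)W = DW(y)y = 2σA' m + (B + B + 2σB')(m·y) y`. -/
theorem fderiv_neutralW_self (y : ℝ³) :
    fderiv ℝ (neutralW m) y y =
      (2 * modeA₁ (‖y‖ ^ 2) * ‖y‖ ^ 2) • m +
        ((modeB (‖y‖ ^ 2) + modeB (‖y‖ ^ 2) + 2 * modeB₁ (‖y‖ ^ 2) * ‖y‖ ^ 2) * ⟪m, y⟫) • y := by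
  rw [(hasFDerivAt_neutralW m y).fderiv]
  simp only [add_apply, smul_apply, ContinuousLinearMap.smulRight_apply, innerSL_apply_apply,
    ContinuousLinearMap.id_apply, real_inner_self_eq_norm_sq, smul_eq_mul]
  module

/-- `ΔW = (4σA'' + 6A') m + 2(B m + 2B'(m·y) y) + (4σB'' + 10B')(m·y) y`. -/
theorem laplacian_neutralW (y : ℝ³) :
    (Δ (neutralW m)) y =
      (4 * modeA₂ (‖y‖ ^ 2) * ‖y‖ ^ 2 + 6 * modeA₁ (‖y‖ ^ 2)) • m +
        ((2 : ℝ) • (modeB (‖y‖ ^ 2) • m + (2 * modeB₁ (‖y‖ ^ 2) * ⟪m, y⟫) • y) +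
          ((4 * modeB₂ (‖y‖ ^ 2) * ‖y‖ ^ 2 + 10 * modeB₁ (‖y‖ ^ 2)) * ⟪m, y⟫) • y) := by
  have hf₁ : ContDiff ℝ 2 (fun w : ℝ³ => modeA (‖w‖ ^ 2) • m) := contDiff_modeA_comp.smul contDiff_const
  have hf₂ : ContDiff ℝ 2 (fun w : ℝ³ => (modeB (‖w‖ ^ 2) * ⟪m, w⟫) • w) :=
    (contDiff_phi m).smul contDiff_id
  have hsplit : neutralW m = (fun w : ℝ³ => modeA (‖w‖ ^ 2) • m) +
      fun w : ℝ³ => (modeB (‖w‖ ^ 2) * ⟪m, w⟫) • w := rfl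
  rw [hsplit, (hf₁.contDiffAt (x := y)).laplacian_add (hf₂.contDiffAt (x := y))]
  -- first summand
  rw [laplacian_smul_const contDiff_modeA_comp m y, laplacian_radial modeA_deriv modeA₁_deriv y]
  -- second summand
  rw [laplacian_smul_field (e := fun w : ℝ³ => w) (contDiff_phi m) contDiff_id y,
    gradient_radial_mul_inner m modeB_deriv y,
    laplacian_radial_mul_inner m modeB_deriv modeB₁_deriv contDiff_modeB_comp y]
  have h0 : (Δ (fun w : ℝ³ => w)) y = 0 := laplacian_clm (ContinuousLinearMap.id ℝ ℝ³) y
  rw [h0, fderiv_fun_id]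
  simp only [smul_zero, zero_add, ContinuousLinearMap.id_apply]

/-- `∇Π = ϖ m + 2ϖ'(m·y) y`. -/
theorem gradient_neutralP (y : ℝ³) :
    gradient (neutralP m) y = modeP (‖y‖ ^ 2) • m + (2 * modeP₁ (‖y‖ ^ 2) * ⟪m, y⟫) • y :=
  gradient_radial_mul_inner m modeP_deriv y

/-- `M W = θ (y·W) y = θ (A + σB)(m·y) y`. -/
theorem neutralM_apply_neutralW (y : ℝ³) :
    neutralM y (neutralW m y) =
      (modeT (‖y‖ ^ 2) * ((modeA (‖y‖ ^ 2) + modeB (‖y‖ ^ 2) * ‖y‖ ^ 2) * ⟪m, y⟫)) • y := by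
  rw [neutralM_apply]
  unfold neutralW
  rw [inner_add_right, inner_smul_right, inner_smul_right, real_inner_self_eq_norm_sq,
    real_inner_comm y m]
  congr 1
  ring

/-- Additivity of the divergence at points of differentiability. -/
theorem divergence_add_of_differentiableAt {u v : ℝ³ → ℝ³} {x : ℝ³} (hu : DifferentiableAt ℝ u x)
    (hv : DifferentiableAt ℝ v x) :
    VectorCalculus.divergence (u + v) x = VectorCalculus.divergence u x + VectorCalculus.divergence v x := by
  unfold VectorCalculus.divergence
  rw [fderiv_add hu hv, ContinuousLinearMap.toLinearMap_add, map_add]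

/-- `div y = 3`. -/
theorem divergence_self (x : ℝ³) : VectorCalculus.divergence (fun w : ℝ³ => w) x = 3 := by
  unfold VectorCalculus.divergence
  rw [fderiv_fun_id, ContinuousLinearMap.coe_id, LinearMap.trace_id, finrank_euclideanSpace_fin]
  norm_num

/-- **`W` is divergence free.** -/
theorem divergence_neutralW (y : ℝ³) : VectorCalculus.divergence (neutralW m) y = 0 := by
  have hd₁ : DifferentiableAt ℝ (fun w : ℝ³ => modeA (‖w‖ ^ 2) • m) y :=
    ((hasFDerivAt_radial modeA_deriv y).smul_const m).differentiableAt
  have hφ : DifferentiableAt ℝ (fun w : ℝ³ => modeB (‖w‖ ^ 2) * ⟪m, w⟫) y :=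
    (hasFDerivAt_radial_mul_inner m modeB_deriv y).differentiableAt
  have hd₂ : DifferentiableAt ℝ (fun w : ℝ³ => (modeB (‖w‖ ^ 2) * ⟪m, w⟫) • w) y :=
    hφ.smul differentiableAt_id
  have hsplit : neutralW m = (fun w : ℝ³ => modeA (‖w‖ ^ 2) • m) +
      fun w : ℝ³ => (modeB (‖w‖ ^ 2) * ⟪m, w⟫) • w := rfl
  rw [hsplit, divergence_add_of_differentiableAt hd₁ hd₂,
    divergence_smul_const m (hasFDerivAt_radial modeA_deriv y).differentiableAt,
    (hasFDerivAt_radial modeA_deriv y).fderiv, divergence_smul_apply (u := fun w : ℝ³ => w) hφ differentiableAt_id,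
    divergence_self,
    gradient_radial_mul_inner m modeB_deriv y]
  simp only [smul_apply, innerSL_apply_apply, smul_eq_mul, inner_add_right, inner_smul_right,
    real_inner_self_eq_norm_sq]
  rw [real_inner_comm m y]
  have hσ := neg_one_lt_norm_sq y
  have h5 : brInv (‖y‖ ^ 2) ^ 5 = brInv (‖y‖ ^ 2) ^ 7 * (1 + ‖y‖ ^ 2) := brInv_pow_eq hσ 5
  unfold modeA₁ modeB modeB₁
  linear_combination (12 * ⟪m, y⟫) * h5

end Formulas


/-! ### §7.7 The identity `ΔW − ½(y·∇)W − ½W − MW − ∇Π = 0` -/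

section Identity

variable (m : ℝ³)

/-- **THE NEUTRAL-MODE IDENTITY** (exact, on all of `ℝ³`): the stationary linearised Leray equation with
potential `M` and pressure `Π` holds for `W`. -/
theorem neutral_identity (y : ℝ³) :
    (Δ (neutralW m)) y - (1 / 2 : ℝ) • fderiv ℝ (neutralW m) y y - (1 / 2 : ℝ) • neutralW m y -
        neutralM y (neutralW m y) - gradient (neutralP m) y = 0 := by
  rw [laplacian_neutralW, fderiv_neutralW_self, neutralM_apply_neutralW, gradient_neutralP]
  unfold neutralW
  have hσ := neg_one_lt_norm_sq y
  have h5 : brInv (‖y‖ ^ 2) ^ 5 = brInv (‖y‖ ^ 2) ^ 13 * (1 + ‖y‖ ^ 2) ^ 4 := by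
    rw [brInv_pow_eq hσ 5, brInv_pow_eq hσ 7, brInv_pow_eq hσ 9, brInv_pow_eq hσ 11]; ring
  have h7 : brInv (‖y‖ ^ 2) ^ 7 = brInv (‖y‖ ^ 2) ^ 13 * (1 + ‖y‖ ^ 2) ^ 3 := by
    rw [brInv_pow_eq hσ 7, brInv_pow_eq hσ 9, brInv_pow_eq hσ 11]; ring
  have h9 : brInv (‖y‖ ^ 2) ^ 9 = brInv (‖y‖ ^ 2) ^ 13 * (1 + ‖y‖ ^ 2) ^ 2 := by
    rw [brInv_pow_eq hσ 9, brInv_pow_eq hσ 11]; ring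
  have h11 : brInv (‖y‖ ^ 2) ^ 11 = brInv (‖y‖ ^ 2) ^ 13 * (1 + ‖y‖ ^ 2) := brInv_pow_eq hσ 11
  unfold modeA modeA₁ modeA₂ modeB modeB₁ modeB₂ modeP modeP₁ modeT
  match_scalars
  · linear_combination ((‖y‖ ^ 2) ^ 3 - 39 / 2 * (‖y‖ ^ 2) ^ 2 + 21 / 2 * ‖y‖ ^ 2 + 31) * h9 +
      (-(3 / 2) * (‖y‖ ^ 2) ^ 2 + 15 * ‖y‖ ^ 2 - 36) * h7 + (5 + ‖y‖ ^ 2 / 2) * h5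
  · linear_combination (105 * ‖y‖ ^ 2 * ⟪m, y⟫) * h9 + ((15 / 2 * ‖y‖ ^ 2 - 105) * ⟪m, y⟫) * h7 +
      (-(9 / 2) * ⟪m, y⟫) * h5 +
      (-(3 * (‖y‖ ^ 2) ^ 3 - 57 / 2 * (‖y‖ ^ 2) ^ 2 - 1077 / 2 * ‖y‖ ^ 2 + 438) * ⟪m, y⟫) * h11

end Identity


/-! ### §7.8 Size: cubic decay of `W`, critical bound `|M| ≤ 30/(1+|y|²)`, non-triviality -/

section Bounds

variable (m : ℝ³)

/-- `|W(y)|² ≤ 4 ζ⁶ = 4/(1+|y|²)³` when `|m| = 1` (equality on the axis `y ∥ m`). -/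
theorem norm_neutralW_sq_le (hm : ‖m‖ = 1) (y : ℝ³) :
    ‖neutralW m y‖ ^ 2 ≤ 4 / (1 + ‖y‖ ^ 2) ^ 3 := by
  have hσ := neg_one_lt_norm_sq y
  set z := brInv (‖y‖ ^ 2) with hz
  have hz0 : 0 ≤ z := (brInv_pos hσ).le
  have hrel : z ^ 2 * (1 + ‖y‖ ^ 2) = 1 := brInv_sq_mul hσ
  have hpos : 0 < 1 + ‖y‖ ^ 2 := one_add_pos hσ
  -- expand the square
  have hexp : ‖neutralW m y‖ ^ 2 =
      modeA (‖y‖ ^ 2) ^ 2 + 2 * (modeA (‖y‖ ^ 2) * (modeB (‖y‖ ^ 2) * ⟪m, y⟫) * ⟪m, y⟫) +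
        (modeB (‖y‖ ^ 2) * ⟪m, y⟫) ^ 2 * ‖y‖ ^ 2 := by
    unfold neutralW
    rw [norm_add_sq_real, norm_smul, norm_smul, inner_smul_left, inner_smul_right, mul_pow, mul_pow,
      hm, Real.norm_eq_abs, Real.norm_eq_abs, sq_abs, sq_abs]
    simp only [RCLike.conj_to_real]
    ring
  have hcs : ⟪m, y⟫ ^ 2 ≤ ‖y‖ ^ 2 := by
    have h1 : |⟪m, y⟫| ≤ ‖m‖ * ‖y‖ := abs_real_inner_le_norm m y
    rw [hm, one_mul] at h1
    nlinarith [abs_nonneg ⟪m, y⟫, sq_abs ⟪m, y⟫]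
  have hkey : modeA (‖y‖ ^ 2) ^ 2 + 2 * (modeA (‖y‖ ^ 2) * (modeB (‖y‖ ^ 2) * ⟪m, y⟫) * ⟪m, y⟫) +
      (modeB (‖y‖ ^ 2) * ⟪m, y⟫) ^ 2 * ‖y‖ ^ 2 =
        z ^ 10 * ((2 - ‖y‖ ^ 2) ^ 2 + ⟪m, y⟫ ^ 2 * (12 + 3 * ‖y‖ ^ 2)) := by
    unfold modeA modeB; ring
  have hmono : z ^ 10 * ((2 - ‖y‖ ^ 2) ^ 2 + ⟪m, y⟫ ^ 2 * (12 + 3 * ‖y‖ ^ 2)) ≤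
      z ^ 10 * ((2 - ‖y‖ ^ 2) ^ 2 + ‖y‖ ^ 2 * (12 + 3 * ‖y‖ ^ 2)) := by
    refine mul_le_mul_of_nonneg_left ?_ (pow_nonneg hz0 10)
    have h12 : 0 ≤ 12 + 3 * ‖y‖ ^ 2 := by positivity
    nlinarith [mul_le_mul_of_nonneg_right hcs h12]
  have hval : z ^ 10 * ((2 - ‖y‖ ^ 2) ^ 2 + ‖y‖ ^ 2 * (12 + 3 * ‖y‖ ^ 2)) = 4 * z ^ 6 := by
    have h6 : z ^ 6 = z ^ 10 * (1 + ‖y‖ ^ 2) ^ 2 := by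
      rw [hz, brInv_pow_eq hσ 6, brInv_pow_eq hσ 8]; ring
    rw [h6]; ring
  have hz6 : z ^ 6 = 1 / (1 + ‖y‖ ^ 2) ^ 3 := by
    have hz2 : z ^ 2 = 1 / (1 + ‖y‖ ^ 2) := by
      field_simp; linarith [hrel]
    calc z ^ 6 = (z ^ 2) ^ 3 := by ring
      _ = 1 / (1 + ‖y‖ ^ 2) ^ 3 := by rw [hz2, div_pow, one_pow]
  calc ‖neutralW m y‖ ^ 2 = z ^ 10 * ((2 - ‖y‖ ^ 2) ^ 2 + ⟪m, y⟫ ^ 2 * (12 + 3 * ‖y‖ ^ 2)) := by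
        rw [hexp, hkey]
    _ ≤ 4 * z ^ 6 := hmono.trans_eq hval
    _ = 4 / (1 + ‖y‖ ^ 2) ^ 3 := by rw [hz6]; ring

/-- The two polynomial inequalities behind `sup (1+σ)|M| = sup (15/4)σ|4σ²+57σ−73|/(1+σ)³ ≈ 28.4 ≤ 30`. -/
theorem poly_bound {σ : ℝ} (hσ : 0 ≤ σ) : |σ * (4 * σ ^ 2 + 57 * σ - 73)| ≤ 8 * (1 + σ) ^ 3 := by
  rw [abs_le]
  constructor
  · nlinarith [sq_nonneg (σ - 49 / 162), mul_nonneg hσ (sq_nonneg σ)]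
  · nlinarith [mul_nonneg hσ (sq_nonneg (σ - 33 / 8))]

/-- **CRITICAL SIZE OF THE POTENTIAL**: `‖M(y)‖ ≤ 30/(1+|y|²)` (operator norm; `~ 15/|y|²` at infinity). -/
theorem norm_neutralM_le (y : ℝ³) : ‖neutralM y‖ ≤ 30 / (1 + ‖y‖ ^ 2) := by
  have hσ := neg_one_lt_norm_sq y
  have hpos : 0 < 1 + ‖y‖ ^ 2 := one_add_pos hσ
  set z := brInv (‖y‖ ^ 2) with hz
  have hz0 : 0 ≤ z := (brInv_pos hσ).le
  have hrel : z ^ 2 * (1 + ‖y‖ ^ 2) = 1 := brInv_sq_mul hσ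
  -- operator norm ≤ |θ| |y|²
  have hop : ‖neutralM y‖ ≤ |modeT (‖y‖ ^ 2)| * ‖y‖ ^ 2 := by
    refine ContinuousLinearMap.opNorm_le_bound _ (by positivity) fun v => ?_
    rw [neutralM_apply, norm_smul, Real.norm_eq_abs, abs_mul]
    have h1 : |⟪y, v⟫| ≤ ‖y‖ * ‖v‖ := abs_real_inner_le_norm y v
    have h2 : 0 ≤ |modeT (‖y‖ ^ 2)| := abs_nonneg _
    calc |modeT (‖y‖ ^ 2)| * |⟪y, v⟫| * ‖y‖ ≤ |modeT (‖y‖ ^ 2)| * (‖y‖ * ‖v‖) * ‖y‖ := by gcongr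
      _ = |modeT (‖y‖ ^ 2)| * ‖y‖ ^ 2 * ‖v‖ := by ring
  -- |θ| σ = (15/4) |σ(4σ²+57σ−73)| z⁸ ≤ 30 z²
  have hz8 : z ^ 8 = (z ^ 2) ^ 4 := by ring
  have hz2 : z ^ 2 = 1 / (1 + ‖y‖ ^ 2) := by field_simp; linarith [hrel]
  have hval : |modeT (‖y‖ ^ 2)| * ‖y‖ ^ 2 =
      15 / 4 * |‖y‖ ^ 2 * (4 * (‖y‖ ^ 2) ^ 2 + 57 * ‖y‖ ^ 2 - 73)| * z ^ 8 := by
    unfold modeT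
    rw [abs_mul, abs_mul, abs_of_nonneg (by norm_num : (0 : ℝ) ≤ 15 / 4), abs_of_nonneg (pow_nonneg hz0 8),
      abs_mul, abs_of_nonneg (sq_nonneg ‖y‖)]
    ring
  have hpoly := poly_bound (sq_nonneg ‖y‖)
  calc ‖neutralM y‖ ≤ |modeT (‖y‖ ^ 2)| * ‖y‖ ^ 2 := hop
    _ = 15 / 4 * |‖y‖ ^ 2 * (4 * (‖y‖ ^ 2) ^ 2 + 57 * ‖y‖ ^ 2 - 73)| * z ^ 8 := hval
    _ ≤ 15 / 4 * (8 * (1 + ‖y‖ ^ 2) ^ 3) * z ^ 8 := by gcongr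
    _ = 30 / (1 + ‖y‖ ^ 2) := by
        rw [hz8, hz2]
        field_simp
        ring

/-- `W(0) = 2m`: the mode is non-trivial (indeed `|W| = 2⟨y⟩⁻³` on the axis). -/
theorem neutralW_zero : neutralW m 0 = (2 : ℝ) • m := by
  unfold neutralW modeA
  simp [brInv_zero]

end Bounds

end Summit.NavierStokesRegularity.NavierStokesRegularity.Theorems.ScarRigidity.Negative

end
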